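import Summits.Parity.GeneralizedHardyLittlewood.Theorems.PrimeLevelFamEdgeMomentsBeyondDiagonalDiagDecorPrimeSqCross
import Summits.Parity.GeneralizedHardyLittlewood.Theorems.PrimeLevelFamEdgeMomentsBeyondDiagonalDiagDecorPrimePowTwo
import HarnessLib

/-!
# Route `PrimeLevelFamEdge`, crux K_A `MomentsBeyondDiagonal` (stmt-Parity-20007), line «petersson_layers» v4, stub `stub_diag`:
# **THE `M₄`-DECORATED COPRIME SELBERG SUM HAS NO MAIN TERM AT ORDER `log^{c+2}y`:
# `|Σ_{k≤y,(k,n)=1} τ(k)W(k)·(3P₂(k)² − 2P₄(k))·logᶜ(y/k)| ≤ C·D(n)(1+κ(n))(1+log y)^{c+1}`** (`c ≥ 2`)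

The arithmetic core of the `M₄ = τ(3P₂² − 2P₄)`-engine asked for by rung 2 of `stub_diag` (`…DiagRungTwoOfM4`; census note in
`…DiagDecorOrderTwoTwoAssembly`): individually the `P₄`- and `P₂²`-decorated coprime sums are of size `E_n log^{c+2}y` with
leading coefficients `−12/((c+1)(c+2))` (`…DiagDecorPrimePowTwo.abs_coprimeSumPow_primePow_add_le_of_two_le`, `i = 3`) and
`−8/((c+1)(c+2))` (`P₂² =` `P₄`-peel `+` cross term, `…DiagDecorPrimePowPeel.sum_copTauW_mul_primeSq_sq_eq` and
`…DiagDecorPrimeSqCross.abs_primeSqCross_sub_le`: `−12 + 4`); in `3P₂² − 2P₄` they cancel (`3·(−8) − 2·(−12) = 0`), leaving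
the relative-precision-`1/log` errors:

* `m4_factorial_identity` — `2c(c−1)·(3!(c−2)!/(c+2)!) = 3·4·(1!c!/(c+2)!)` (`c ≥ 2`), the cancellation of the main terms;
* `abs_coprimeSumPow_M4_le` — **the displayed bound** (`c ≥ 2`, `n ≥ 1`, `y ≥ 1`).

This is the inner-sum size ("`s = −1`" in the two-scale language: one log above the `P₂`-format, three below the trivial bound)
from which the four `M₄`-family Selberg-form bounds (M4) of `…DiagDecorOrderTwoTwoPoly` follow by a crude (absolute-value)
harmonic summation over `(c, g)`; that last, purely book-keeping layer is what remains of (M4). Def-free; theorems only.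
Helper `--supports stmt-Parity-20007`; closes nothing; K_A, K_B and the Parity summit are NOT proved; nothing about
Landau–Siegel zeros.

## References
* E. Kowalski, P. Michel, J. VanderKam, J. reine angew. Math. 526 (2000), (23)–(28) pp. 13–15 and Prop. 5.1 p. 18.
  [cite: KowalskiMichelVanderKam2000, (23)–(28) — derivation (fourth central divisor-log moment of the Selberg coordinates)]
-/

noncomputable section

open scoped Real
open Finset ArithmeticFunction

namespace Summit.Parity.GeneralizedHardyLittlewood.Theorems.MomentsBeyondDiagonal.DiagKernel

open Literature.NumberTheory.LFunctions Literature.NumberTheory.LFunctions.KMV2000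
open SelbergCoord (kappa)
open Summit.Parity.GeneralizedHardyLittlewood.Theorems.BeyondDiagonalBeatsQuarter.KernelFormXSq
  (copTauW mainConst divWeight divWeight_nonneg mainConst_nonneg)
open Summit.Parity.GeneralizedHardyLittlewood.Theorems.MomentsBeyondDiagonal.DiagLines
  (sum_copTauW_mul_mul_sum_primeFactors_eq sum_copTauW_mul_primeSq_sq_eq)

/-- The cancellation of the `log^{c+2}` main terms in `3P₂² − 2P₄`: for `c ≥ 2`,
`2c(c−1)·(3!·(c−2)!/(c−2+3+1)!) = 3·(4·(1!·c!/(c+1+1)!))` (both are `12·c!/(c+2)!`). [folklore] -/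
theorem m4_factorial_identity {c : ℕ} (hc : 2 ≤ c) :
    2 * ((c : ℝ) * ((c : ℝ) - 1)) * (((Nat.factorial 3 : ℕ) : ℝ) * (c - 2).factorial / (c - 2 + 3 + 1).factorial) =
      3 * (4 * (((Nat.factorial 1 : ℕ) : ℝ) * c.factorial / (c + 1 + 1).factorial)) := by
  obtain ⟨m, rfl⟩ : ∃ m, c = m + 2 := ⟨c - 2, by omega⟩
  have e1 : m + 2 - 2 = m := by omega
  have e2 : m + 3 + 1 = m + 2 + 1 + 1 := by omega
  rw [e1, e2]
  have h2 : ((m + 2).factorial : ℝ) = ((m : ℝ) + 2) * ((m : ℝ) + 1) * m.factorial := by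
    have : (m + 2).factorial = (m + 2) * ((m + 1) * m.factorial) := by
      rw [show m + 2 = (m + 1) + 1 by omega, Nat.factorial_succ, Nat.factorial_succ]
    rw [this]; push_cast; ring
  have hF : ((m + 2 + 1 + 1).factorial : ℝ) ≠ 0 := by exact_mod_cast Nat.factorial_ne_zero _
  rw [h2, show Nat.factorial 3 = 6 from rfl, show Nat.factorial 1 = 1 from rfl]
  push_cast
  field_simp
  ring

/-- **The `M₄`-decorated coprime Selberg sum is `O(D(n)(1+κ(n))(1+log y)^{c+1})`** (`c ≥ 2`): there is `C` with, for all
`n ≥ 1`, `y ≥ 1`, `|Σ_{k≤y} a_n(k)·logᶜ(y/k)·(3P₂(k)² − 2P₄(k))| ≤ C·D(n)(1+κ(n))(1+log y)^{c+1}`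
(`a_n = copTauW n`, `P_m(k) = Σ_{p∣k}log^m p`). [cite: KowalskiMichelVanderKam2000, (23)–(28) — derivation] -/
theorem abs_coprimeSumPow_M4_le {c : ℕ} (hc : 2 ≤ c) :
    ∃ C : ℝ, 0 < C ∧ ∀ n : ℕ, n ≠ 0 → ∀ y : ℝ, 1 ≤ y →
      |∑ k ∈ Icc 1 ⌊y⌋₊, copTauW n k * Real.log (y / k) ^ c *
          (3 * (∑ p ∈ k.primeFactors, Real.log p ^ 2) ^ 2 - 2 * ∑ p ∈ k.primeFactors, Real.log p ^ 4)| ≤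
        C * divWeight n * (1 + kappa n) * (1 + Real.log y) ^ (c + 1) := by
  obtain ⟨C₁, hC₁, h₁⟩ := abs_coprimeSumPow_primePow_add_le_of_two_le 3 hc
  obtain ⟨C₂, hC₂, h₂⟩ := abs_primeSqCross_sub_le hc
  refine ⟨C₁ + 3 * C₂, by positivity, fun n hn y hy ↦ ?_⟩
  set N := ⌊y⌋₊ with hN
  have hP4 := h₁ n hn y hy
  have hX := h₂ n hn y hy
  -- the main terms agree: `2c(c−1)q₃ = 3·4·q₁`, exponents `c−2+3(+1) = c+1(+1)`
  have hid := m4_factorial_identity hc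
  have e34 : c - 2 + 3 = c + 1 := by omega
  rw [show ((3 : ℕ) + 1) = 4 from rfl] at hP4
  rw [e34] at hP4 hid
  -- the algebraic decomposition `Σ aG(3P₂² − 2P₄) = Σ aGP₄ + 3·CROSS`
  have hpeel4 := sum_copTauW_mul_mul_sum_primeFactors_eq n N (fun k : ℕ ↦ Real.log (y / k) ^ c)
    (fun p : ℕ ↦ Real.log p ^ 4)
  have hsq := sum_copTauW_mul_primeSq_sq_eq n N 2 (fun k : ℕ ↦ Real.log (y / k) ^ c)
  beta_reduce at hpeel4 hsq
  rw [show 2 * 2 = 4 from rfl, ← hpeel4] at hsq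
  have hdec : ∑ k ∈ Icc 1 N, copTauW n k * Real.log (y / k) ^ c *
        (3 * (∑ p ∈ k.primeFactors, Real.log p ^ 2) ^ 2 - 2 * ∑ p ∈ k.primeFactors, Real.log p ^ 4) =
      (∑ k ∈ Icc 1 N, copTauW n k * Real.log (y / k) ^ c * ∑ p ∈ k.primeFactors, Real.log p ^ 4) +
        3 * ∑ p ∈ (Icc 1 N).filter Nat.Prime, Real.log p ^ 2 * copTauW n p *
          ∑ k ∈ Icc 1 (N / p), copTauW (n * p) k *
            (Real.log (y / ((p * k : ℕ) : ℝ)) ^ c * ∑ q ∈ k.primeFactors, Real.log q ^ 2) := by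
    have hlin : ∑ k ∈ Icc 1 N, copTauW n k * Real.log (y / k) ^ c *
          (3 * (∑ p ∈ k.primeFactors, Real.log p ^ 2) ^ 2 - 2 * ∑ p ∈ k.primeFactors, Real.log p ^ 4) =
        3 * ∑ k ∈ Icc 1 N, copTauW n k * Real.log (y / k) ^ c *
            ((∑ q ∈ k.primeFactors, Real.log q ^ 2) * ∑ q ∈ k.primeFactors, Real.log q ^ 2) -
          2 * ∑ k ∈ Icc 1 N, copTauW n k * Real.log (y / k) ^ c * ∑ p ∈ k.primeFactors, Real.log p ^ 4 := by
      rw [Finset.mul_sum, Finset.mul_sum, ← Finset.sum_sub_distrib]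
      refine Finset.sum_congr rfl fun k _ ↦ ?_
      ring
    rw [hlin, hsq]
    ring
  rw [hdec]
  -- assemble
  have key : ∀ {A X M₁ M₂ : ℝ}, M₁ = 3 * M₂ → A + 3 * X = (A + M₁) + 3 * (X - M₂) := by
    intro A X M₁ M₂ h; rw [h]; ring
  rw [key (A := ∑ k ∈ Icc 1 N, copTauW n k * Real.log (y / k) ^ c * ∑ p ∈ k.primeFactors, Real.log p ^ 4)
    (M₁ := 2 * ((c : ℝ) * ((c : ℝ) - 1)) * (((Nat.factorial 3 : ℕ) : ℝ) * (c - 2).factorial / (c + 1 + 1).factorial) *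
      mainConst n * Real.log y ^ (c + 1 + 1))
    (M₂ := 4 * (((Nat.factorial 1 : ℕ) : ℝ) * c.factorial / (c + 1 + 1).factorial) * mainConst n * Real.log y ^ (c + 1 + 1))
    (by rw [show 2 * ((c : ℝ) * ((c : ℝ) - 1)) * (((Nat.factorial 3 : ℕ) : ℝ) * (c - 2).factorial / (c + 1 + 1).factorial) *
        mainConst n * Real.log y ^ (c + 1 + 1) =
        (2 * ((c : ℝ) * ((c : ℝ) - 1)) * (((Nat.factorial 3 : ℕ) : ℝ) * (c - 2).factorial / (c + 1 + 1).factorial)) *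
          (mainConst n * Real.log y ^ (c + 1 + 1)) by ring, hid]; ring)]
  have hD := divWeight_nonneg n
  have hκ : 0 ≤ kappa n := by
    unfold kappa
    exact Finset.sum_nonneg fun p hp ↦ by
      have hp2 : (2 : ℝ) ≤ p := by exact_mod_cast (Nat.prime_of_mem_primeFactors hp).two_le
      exact div_nonneg (Real.log_nonneg (by linarith)) (by linarith)
  have hly : 0 ≤ Real.log y := Real.log_nonneg hy
  calc _ ≤ |∑ k ∈ Icc 1 N, copTauW n k * Real.log (y / k) ^ c * ∑ p ∈ k.primeFactors, Real.log p ^ 4 +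
          2 * ((c : ℝ) * ((c : ℝ) - 1)) * (((Nat.factorial 3 : ℕ) : ℝ) * (c - 2).factorial / (c + 1 + 1).factorial) *
            mainConst n * Real.log y ^ (c + 1 + 1)| +
        |3 * (∑ p ∈ (Icc 1 N).filter Nat.Prime, Real.log p ^ 2 * copTauW n p *
          ∑ k ∈ Icc 1 (N / p), copTauW (n * p) k *
            (Real.log (y / ((p * k : ℕ) : ℝ)) ^ c * ∑ q ∈ k.primeFactors, Real.log q ^ 2) -
          4 * (((Nat.factorial 1 : ℕ) : ℝ) * c.factorial / (c + 1 + 1).factorial) * mainConst n * Real.log y ^ (c + 1 + 1))| :=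
        abs_add_le _ _
    _ ≤ C₁ * divWeight n * (1 + kappa n) * (1 + Real.log y) ^ (c + 1) +
        3 * (C₂ * divWeight n * (1 + kappa n) * (1 + Real.log y) ^ (c + 1)) := by
        refine add_le_add hP4 ?_
        rw [abs_mul, abs_of_pos (by norm_num : (0 : ℝ) < 3)]
        exact mul_le_mul_of_nonneg_left hX (by norm_num)
    _ = (C₁ + 3 * C₂) * divWeight n * (1 + kappa n) * (1 + Real.log y) ^ (c + 1) := by ring

end Summit.Parity.GeneralizedHardyLittlewood.Theorems.MomentsBeyondDiagonal.DiagKernel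

end
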